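import Summits.AtomisticToContinuum.BoseEinsteinCondensation.Theorems.BECInfDivCoherenceLevyMassCondensationTranslation
import Summits.AtomisticToContinuum.BoseEinsteinCondensation.Theorems.BECInfDivCoherenceLevyMassCondensationEnergy
import Summits.AtomisticToContinuum.BoseEinsteinCondensation.Theorems.BECInfDivCoherenceGridAverageCondensate
import Literature.MathematicalPhysics.QuantumManyBody.PeriodicHeatFlowSpectralProofs
import HarnessLib

/-!
# Crux `LevyNegativeMoment` (stmt-AtomisticToContinuum-9115), line `registered`:
# the near field of the coherence is controlled by the kinetic energy — for every admissible potential

Support file (`--supports stmt-AtomisticToContinuum-9115`; lead c4).  The registered stub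
`stub_logClusterL1` asks for an `N`- and `ρ`-uniform weighted-ℓ¹ bound on the grid values of
`log G_Ψ`, `G_Ψ(i, r) = Re ∫_{cell^N} conj Ψ(…, xᵢ + r, …) Ψ(X) dX`, for near-minimisers `Ψ` of the
periodic `N`-body energy.  This file proves the part of that control which holds for EVERY admissible
potential (hard cores included) with no spectral input — the NEAR FIELD — and isolates the rest as the
infrared (BEC-strength) content:

* `one_sub_coh_add_le` — doubling: `1 - G(r₁ + r₂) ≤ 2(1 - G(r₁)) + 2(1 - G(r₂))` (the `L²`-increment is a
  cocycle; shift invariance of the cell integral);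
* `one_sub_coh_le_norm_sq` — `1 - G(i, r) ≤ 2‖r‖² Tᵢ`, `Tᵢ = Σ_k ∫ |∂_{ik}Ψ|²` (the glue's axis bound
  `InfDivGlue.one_sub_coh_le` in a general direction);
* `coh_eq_coh` — the coherence does not depend on the tagged particle (Bose symmetry), whence
  `one_sub_coh_le_kinetic` — `1 - G(i, r) ≤ 2‖r‖² T/N` for EVERY particle from the TOTAL kinetic energy `T`;
* `nearField_coherence` — for every repulsive finite-range `v`: `K > 0`, `ρ₀ > 0` such that for
  `0 < ρ < ρ₀`, all large `N`, every periodic state with energy `≤ E₀^per + ρN` (an extensive slack) has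
  `1 - G(i, r) ≤ Kρ‖r‖²` for all `i, r` (Dyson–LSSY ceiling `E₀^per ≤ 16πRρN` through the hard core of radius
  `2R`, `InfDivGlue.periodicGroundStateEnergy_le_uniform`; `K = 2(16πR + 1)`, `R = max R₀ 1`);
  `nearField_coherence_nearMinimiser` — the same in the crux's `∃ δ`-after-`N` shape;
* `nearField_log_coherence` — in the near field `Kρ‖r‖² ≤ 1/2`: `G ≥ 1/2` and `|log G| ≤ 2Kρ‖r‖²`.

Consequences recorded for the line (no new stub is claimed closed): the near zone `|r| ≲ (Kρ)^{-1/2}`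
(a fixed multiple of the healing length when `a ≍ R`) of `stub_logClusterL1` (centring `c = 0`) and of the
positivity conjunct of the sister crux `GridInfDivCoherence` hold unconditionally and uniformly in `N`;
what remains of either is the behaviour of `G_Ψ` beyond the healing scale, i.e. off-diagonal long-range
order in the thermodynamic limit.

References: E. H. Lieb, R. Seiringer, J. P. Solovej, J. Yngvason, *The Mathematics of the Bose Gas and
its Condensation* (2005), Thm. 2.2 and §1.2; S. Stringari, in *Bose–Einstein Condensation* (CUP 1995), §2
(kinetic sum rule for the coherence); L. Pitaevskii, S. Stringari, J. Low Temp. Phys. 85 (1991) 377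
(uncertainty-type bounds on coherence at `T = 0`).
-/

noncomputable section

namespace Summit.AtomisticToContinuum.BoseEinsteinCondensation.Theorems.CoherenceNearField

open MeasureTheory Filter Literature.MathematicalPhysics.QuantumManyBody
  Literature.MathematicalPhysics.QuantumManyBody.BoseGas InfDivGlue BECInfDivCoherenceGridAverage
open scoped ENNReal NNReal ComplexConjugate

variable {N : ℕ} {L : ℝ}

/-- `‖a - c‖² ≤ 2‖a - b‖² + 2‖b - c‖²` in a normed group. [folklore] -/
theorem norm_sub_sq_le_two_mul {E : Type*} [SeminormedAddCommGroup E] (a b c : E) :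
    ‖a - c‖ ^ 2 ≤ 2 * ‖a - b‖ ^ 2 + 2 * ‖b - c‖ ^ 2 := by
  have h := norm_sub_le_norm_sub_add_norm_sub a b c
  nlinarith [h, norm_nonneg (a - c), norm_nonneg (a - b), norm_nonneg (b - c),
    sq_nonneg (‖a - b‖ - ‖b - c‖)]

/-- **Doubling (subadditivity of the coherence deficit)**: for a periodic trial state and a particle `i`,
`1 - G(r₁ + r₂) ≤ 2(1 - G(r₁)) + 2(1 - G(r₂))` — the `L²`-increment `X ↦ Ψ(X + eᵢ ⊗ r)` is a cocycle for
the translation group and the cell integral is shift invariant (`one_sub_coh_eq`,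
`setIntegral_cellN_comp_add`). [folklore] -/
theorem one_sub_coh_add_le (hL : 0 < L) (Ψ : PeriodicTrialState N L) (i : Fin N) (r₁ r₂ : Space) :
    1 - (∫ X in cellN N L, conj (Ψ.ψ (Function.update X i (X i + (r₁ + r₂)))) * Ψ.ψ X).re ≤
      2 * (1 - (∫ X in cellN N L, conj (Ψ.ψ (Function.update X i (X i + r₁))) * Ψ.ψ X).re) +
        2 * (1 - (∫ X in cellN N L, conj (Ψ.ψ (Function.update X i (X i + r₂))) * Ψ.ψ X).re) := by
  rw [one_sub_coh_eq hL Ψ i, one_sub_coh_eq hL Ψ i, one_sub_coh_eq hL Ψ i]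
  have hc := Ψ.contDiff.continuous
  set B : Config N → ℝ := fun X => ‖Ψ.ψ (X + Pi.single i r₁) - Ψ.ψ X‖ ^ 2 with hB
  have hBper : ∀ (X : Config N) (j : Fin N) (k : Fin 3),
      B (X + Pi.single j (EuclideanSpace.single k L)) = B X := by
    intro X j k
    simp only [hB]
    rw [add_right_comm, Ψ.periodic, Ψ.periodic]
  have hshift : ∫ X in cellN N L, B (X + Pi.single i r₂) = ∫ X in cellN N L, B X :=
    setIntegral_cellN_comp_add hL hBper _
  have hpt : ∀ X : Config N, ‖Ψ.ψ (X + Pi.single i (r₁ + r₂)) - Ψ.ψ X‖ ^ 2 ≤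
      2 * B (X + Pi.single i r₂) + 2 * ‖Ψ.ψ (X + Pi.single i r₂) - Ψ.ψ X‖ ^ 2 := by
    intro X
    simp only [hB]
    have e : X + Pi.single i r₂ + Pi.single i r₁ = X + Pi.single i (r₁ + r₂) := by
      rw [add_assoc, ← Pi.single_add, add_comm r₂ r₁]
    rw [e]
    exact norm_sub_sq_le_two_mul _ _ _
  have hcA : Continuous fun X : Config N => ‖Ψ.ψ (X + Pi.single i (r₁ + r₂)) - Ψ.ψ X‖ ^ 2 :=
    ((hc.comp (continuous_id.add continuous_const)).sub hc).norm.pow 2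
  have hcB : Continuous B := ((hc.comp (continuous_id.add continuous_const)).sub hc).norm.pow 2
  have hcBs : Continuous fun X : Config N => B (X + Pi.single i r₂) :=
    hcB.comp (continuous_id.add continuous_const)
  have hcC : Continuous fun X : Config N => ‖Ψ.ψ (X + Pi.single i r₂) - Ψ.ψ X‖ ^ 2 :=
    ((hc.comp (continuous_id.add continuous_const)).sub hc).norm.pow 2
  have hle : ∫ X in cellN N L, ‖Ψ.ψ (X + Pi.single i (r₁ + r₂)) - Ψ.ψ X‖ ^ 2 ≤
      ∫ X in cellN N L, (2 * B (X + Pi.single i r₂) + 2 * ‖Ψ.ψ (X + Pi.single i r₂) - Ψ.ψ X‖ ^ 2) :=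
    integral_mono (integrableOn_cellN hcA L) ((integrableOn_cellN (hcBs.const_mul 2) L).add
      (integrableOn_cellN (hcC.const_mul 2) L)) hpt
  rw [integral_add (integrableOn_cellN (hcBs.const_mul 2) L) (integrableOn_cellN (hcC.const_mul 2) L),
    integral_const_mul, integral_const_mul, hshift] at hle
  simp only [hB] at hle
  linarith


/-- Axis decomposition of a vector of `ℝ³`: `r = (r₀ e₀ + r₁ e₁) + r₂ e₂`. [folklore] -/
theorem eq_sum_smul_single (r : Space) :
    r = (r 0 • EuclideanSpace.single (0 : Fin 3) (1 : ℝ) + r 1 • EuclideanSpace.single (1 : Fin 3) (1 : ℝ)) +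
      r 2 • EuclideanSpace.single (2 : Fin 3) (1 : ℝ) := by
  ext j
  fin_cases j <;> simp

/-- `‖r‖² = r₀² + r₁² + r₂²` on `ℝ³`. [folklore] -/
theorem norm_sq_eq_three (r : Space) : ‖r‖ ^ 2 = r 0 ^ 2 + r 1 ^ 2 + r 2 ^ 2 := by
  rw [EuclideanSpace.norm_sq_eq, Fin.sum_univ_three]
  simp only [Real.norm_eq_abs, sq_abs]

/-- **Kinetic bound on the coherence deficit in a general direction**: for a periodic trial state, a
particle `i` with finite kinetic energy `Tᵢ = Σ_k ∫_{cell^N} |∂_{ik}Ψ|²`, and any `r ∈ ℝ³`,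
`1 - G(r) ≤ 2‖r‖² Tᵢ` (axis bound `one_sub_coh_le` + doubling twice). [folklore] -/
theorem one_sub_coh_le_norm_sq (hL : 0 < L) (Ψ : PeriodicTrialState N L) (i : Fin N) (r : Space)
    (hfin : (∑ k : Fin 3, ∫⁻ X in cellN N L,
      (‖fderiv ℝ Ψ.ψ X (Pi.single i (EuclideanSpace.single k (1 : ℝ)))‖₊ : ℝ≥0∞) ^ 2) ≠ ⊤) :
    1 - (∫ X in cellN N L, conj (Ψ.ψ (Function.update X i (X i + r))) * Ψ.ψ X).re ≤
      2 * ‖r‖ ^ 2 * (∑ k : Fin 3, ∫⁻ X in cellN N L,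
        (‖fderiv ℝ Ψ.ψ X (Pi.single i (EuclideanSpace.single k (1 : ℝ)))‖₊ : ℝ≥0∞) ^ 2).toReal := by
  set T : Fin 3 → ℝ≥0∞ := fun k => ∫⁻ X in cellN N L,
    (‖fderiv ℝ Ψ.ψ X (Pi.single i (EuclideanSpace.single k (1 : ℝ)))‖₊ : ℝ≥0∞) ^ 2 with hT
  have hTk : ∀ k, T k ≠ ⊤ := fun k =>
    ne_top_of_le_ne_top hfin (Finset.single_le_sum (f := T) (fun _ _ => bot_le) (Finset.mem_univ k))
  have hTk' : ∀ k, (T k).toReal ≤ (∑ k, T k).toReal := fun k =>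
    ENNReal.toReal_mono hfin (Finset.single_le_sum (f := T) (fun _ _ => bot_le) (Finset.mem_univ k))
  -- axis bounds
  have hax : ∀ k : Fin 3, 1 - (∫ X in cellN N L, conj (Ψ.ψ (Function.update X i
      (X i + r k • EuclideanSpace.single k (1 : ℝ)))) * Ψ.ψ X).re ≤ (r k) ^ 2 / 2 * (∑ k, T k).toReal := by
    intro k
    calc 1 - (∫ X in cellN N L, conj (Ψ.ψ (Function.update X i
          (X i + r k • EuclideanSpace.single k (1 : ℝ)))) * Ψ.ψ X).re
        ≤ (r k) ^ 2 / 2 * (T k).toReal := one_sub_coh_le hL Ψ i k (r k) (hTk k)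
      _ ≤ (r k) ^ 2 / 2 * (∑ k, T k).toReal :=
          mul_le_mul_of_nonneg_left (hTk' k) (by positivity)
  have h01 := one_sub_coh_add_le hL Ψ i (r 0 • EuclideanSpace.single (0 : Fin 3) (1 : ℝ))
    (r 1 • EuclideanSpace.single (1 : Fin 3) (1 : ℝ))
  have h012 := one_sub_coh_add_le hL Ψ i
    (r 0 • EuclideanSpace.single (0 : Fin 3) (1 : ℝ) + r 1 • EuclideanSpace.single (1 : Fin 3) (1 : ℝ))
    (r 2 • EuclideanSpace.single (2 : Fin 3) (1 : ℝ))
  rw [← eq_sum_smul_single r] at h012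
  have h0 := hax 0
  have h1 := hax 1
  have h2 := hax 2
  have hsum : 0 ≤ (∑ k, T k).toReal := ENNReal.toReal_nonneg
  rw [norm_sq_eq_three]
  nlinarith [h012, h01, h0, h1, h2, hsum, sq_nonneg (r 0), sq_nonneg (r 1), sq_nonneg (r 2)]

/-- **The coherence does not depend on the tagged particle** (Bose symmetry: relabel by the
transposition `(0 i)`, `setIntegral_cellN_comp_perm`). [folklore] -/
theorem coh_eq_coh_zero {n : ℕ} (Ψ : PeriodicTrialState (n + 1) L) (i : Fin (n + 1)) (r : Space) :
    (∫ X in cellN (n + 1) L, conj (Ψ.ψ (Function.update X i (X i + r))) * Ψ.ψ X).re =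
      (∫ X in cellN (n + 1) L, conj (Ψ.ψ (Function.update X 0 (X 0 + r))) * Ψ.ψ X).re := by
  congr 1
  set F : Config (n + 1) → ℂ := fun Z => conj (Ψ.ψ (Z + Pi.single 0 r)) * Ψ.ψ Z with hF
  have h1 : (fun X : Config (n + 1) => conj (Ψ.ψ (Function.update X i (X i + r))) * Ψ.ψ X) =
      fun X => F (X ∘ Equiv.swap 0 i) :=
    funext fun X => conj_update_mul_eq_comp_swap Ψ i r X
  rw [h1, setIntegral_cellN_comp_perm L (Equiv.swap 0 i) F]
  refine integral_congr_ae (ae_of_all _ fun X => ?_)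
  simp only [hF, update_eq_add_single]

/-- Any two particles have the same coherence. [folklore] -/
theorem coh_eq_coh (Ψ : PeriodicTrialState N L) (i j : Fin N) (r : Space) :
    (∫ X in cellN N L, conj (Ψ.ψ (Function.update X i (X i + r))) * Ψ.ψ X).re =
      (∫ X in cellN N L, conj (Ψ.ψ (Function.update X j (X j + r))) * Ψ.ψ X).re := by
  cases N with
  | zero => exact (Fin.elim0 i : False).elim
  | succ n => rw [coh_eq_coh_zero Ψ i r, coh_eq_coh_zero Ψ j r]

/-- **Kinetic bound, total form**: if the TOTAL kinetic energy of a periodic `N`-boson trial state is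
`≤ T < ∞`, then every particle `i` and every `r ∈ ℝ³` satisfy `1 - G(r) ≤ 2‖r‖² · T/N` (pigeonhole gives a
particle with kinetic energy `≤ T/N`, and the coherence is the same for all particles). [folklore] -/
theorem one_sub_coh_le_kinetic (hL : 0 < L) (Ψ : PeriodicTrialState N L) {T : ℝ≥0∞}
    (hT : (∫⁻ X in cellN N L, kineticDensity Ψ.ψ X) ≤ T) (hTtop : T ≠ ⊤) (i : Fin N) (r : Space) :
    1 - (∫ X in cellN N L, conj (Ψ.ψ (Function.update X i (X i + r))) * Ψ.ψ X).re ≤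
      2 * ‖r‖ ^ 2 * (T / N).toReal := by
  have hN : 0 < N := Fin.pos i
  obtain ⟨i₀, hi₀⟩ := exists_particle_kinetic_le Ψ hN hT
  have hTN : T / N ≠ ⊤ := ENNReal.div_ne_top hTtop (Nat.cast_ne_zero.2 hN.ne')
  have hfin : (∑ k : Fin 3, ∫⁻ X in cellN N L,
      (‖fderiv ℝ Ψ.ψ X (Pi.single i₀ (EuclideanSpace.single k (1 : ℝ)))‖₊ : ℝ≥0∞) ^ 2) ≠ ⊤ :=
    ne_top_of_le_ne_top hTN hi₀
  rw [coh_eq_coh Ψ i i₀ r]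
  calc 1 - (∫ X in cellN N L, conj (Ψ.ψ (Function.update X i₀ (X i₀ + r))) * Ψ.ψ X).re
      ≤ 2 * ‖r‖ ^ 2 * (∑ k : Fin 3, ∫⁻ X in cellN N L,
          (‖fderiv ℝ Ψ.ψ X (Pi.single i₀ (EuclideanSpace.single k (1 : ℝ)))‖₊ : ℝ≥0∞) ^ 2).toReal :=
        one_sub_coh_le_norm_sq hL Ψ i₀ r hfin
    _ ≤ 2 * ‖r‖ ^ 2 * (T / N).toReal :=
        mul_le_mul_of_nonneg_left (ENNReal.toReal_mono hTN hi₀) (by positivity)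

/-! ### Low-energy states at small density: the near field, for every admissible potential -/

/-- The kinetic energy is part of the periodic energy. [folklore] -/
theorem lintegral_kinetic_le_periodicEnergy (v : ℝ → ℝ≥0∞) (Ψ : PeriodicTrialState N L) :
    (∫⁻ X in cellN N L, kineticDensity Ψ.ψ X) ≤ periodicEnergy v Ψ :=
  lintegral_mono fun _ => le_self_add

/-- **Near-field coherence of low-energy states, uniformly in `N` (every admissible potential, hard cores
included).**  For every repulsive finite-range `v` there are `K > 0` and `ρ₀ > 0` such that for
`0 < ρ < ρ₀` and all large `N`, EVERY periodic trial state `Ψ` of `N` bosons on the torus of side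
`L_N = (N/ρ)^{1/3}` whose energy exceeds the ground-state energy by at most the EXTENSIVE amount `ρN`
satisfies, for every particle `i` and every `r ∈ ℝ³`,
`1 - Re ∫_{cell^N} conj Ψ(…, xᵢ + r, …) Ψ(X) dX ≤ K ρ ‖r‖²`.
Ingredients: the Dyson–LSSY ceiling `E₀^per ≤ 16πRρN` (`periodicGroundStateEnergy_le_uniform`, through the
hard core of radius `2R`, `R = max R₀ 1`) and the kinetic bound `one_sub_coh_le_kinetic`; `K = 2(16πR + 1)`.
So low-energy states are coherent (`G ≥ 1/2`) out to `|r| ≍ (Kρ)^{-1/2}`, a fixed multiple of the healing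
length `(8πaρ)^{-1/2}` when `a ≍ R`. [folklore] -/
theorem nearField_coherence :
    ∀ v : ℝ → ℝ≥0∞, IsRepulsiveFiniteRange v → ∃ K : ℝ, 0 < K ∧ ∃ ρ₀ : ℝ, 0 < ρ₀ ∧
      ∀ ρ : ℝ, 0 < ρ → ρ < ρ₀ → ∀ᶠ N : ℕ in atTop, ∀ Ψ : PeriodicTrialState N (sideLength ρ N),
        periodicEnergy v Ψ ≤ periodicGroundStateEnergy v N (sideLength ρ N) + ENNReal.ofReal (ρ * N) →
          ∀ (i : Fin N) (r : Space),
            1 - (∫ X in cellN N (sideLength ρ N),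
              conj (Ψ.ψ (Function.update X i (X i + r))) * Ψ.ψ X).re ≤ K * ρ * ‖r‖ ^ 2 := by
  intro v hv
  obtain ⟨R₀, hR₀⟩ := hv.2
  set R : ℝ := max R₀ 1 with hR
  have hRpos : 0 < R := lt_of_lt_of_le one_pos (le_max_right _ _)
  have hvR : ∀ r, R < r → v r = 0 := fun r hr => hR₀ r (lt_of_le_of_lt (le_max_left _ _) hr)
  obtain ⟨ρ₁, hρ₁, H⟩ := periodicGroundStateEnergy_le_uniform hRpos
  refine ⟨2 * (16 * Real.pi * R + 1), by positivity, ρ₁, hρ₁, fun ρ hρ hρlt => ?_⟩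
  filter_upwards [H ρ hρ hρlt, eventually_gt_atTop 0] with N hN hNpos Ψ hΨ i r
  have hL : 0 < sideLength ρ N := by
    unfold sideLength
    exact Real.rpow_pos_of_pos (div_pos (Nat.cast_pos.2 hNpos) hρ) _
  set T : ℝ≥0∞ := ENNReal.ofReal ((16 * Real.pi * R + 1) * ρ * N) with hT
  have hkin : (∫⁻ X in cellN N (sideLength ρ N), kineticDensity Ψ.ψ X) ≤ T := by
    calc (∫⁻ X in cellN N (sideLength ρ N), kineticDensity Ψ.ψ X) ≤ periodicEnergy v Ψ :=
          lintegral_kinetic_le_periodicEnergy v Ψ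
      _ ≤ periodicGroundStateEnergy v N (sideLength ρ N) + ENNReal.ofReal (ρ * N) := hΨ
      _ ≤ ENNReal.ofReal (16 * Real.pi * R * ρ * N) + ENNReal.ofReal (ρ * N) :=
          add_le_add (hN v hvR) le_rfl
      _ = T := by
          rw [hT, ← ENNReal.ofReal_add (by positivity) (by positivity)]
          congr 1
          ring
  have key := one_sub_coh_le_kinetic hL Ψ hkin ENNReal.ofReal_ne_top i r
  have hTN : (T / N).toReal = (16 * Real.pi * R + 1) * ρ := by
    rw [hT, ENNReal.toReal_div, ENNReal.toReal_ofReal (by positivity), ENNReal.toReal_natCast]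
    have hN' : (N : ℝ) ≠ 0 := Nat.cast_ne_zero.2 hNpos.ne'
    field_simp
  rw [hTN] at key
  calc 1 - (∫ X in cellN N (sideLength ρ N), conj (Ψ.ψ (Function.update X i (X i + r))) * Ψ.ψ X).re
      ≤ 2 * ‖r‖ ^ 2 * ((16 * Real.pi * R + 1) * ρ) := key
    _ = 2 * (16 * Real.pi * R + 1) * ρ * ‖r‖ ^ 2 := by ring

/-- **The same in the crux's quantifier shape** (`δ` after `N`; here `δ = ρN` works): for every admissible
`v` there are `K > 0`, `ρ₀ > 0` with: for `0 < ρ < ρ₀`, for all large `N`, some `δ > 0` makes every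
`δ`-near-minimiser satisfy `1 - G_Ψ(i, r) ≤ Kρ‖r‖²` for all `i`, `r`. [folklore] -/
theorem nearField_coherence_nearMinimiser :
    ∀ v : ℝ → ℝ≥0∞, IsRepulsiveFiniteRange v → ∃ K : ℝ, 0 < K ∧ ∃ ρ₀ : ℝ, 0 < ρ₀ ∧
      ∀ ρ : ℝ, 0 < ρ → ρ < ρ₀ → ∀ᶠ N : ℕ in atTop, ∃ δ : ℝ≥0∞, 0 < δ ∧
        ∀ Ψ : PeriodicTrialState N (sideLength ρ N),
          periodicEnergy v Ψ ≤ periodicGroundStateEnergy v N (sideLength ρ N) + δ →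
            ∀ (i : Fin N) (r : Space),
              1 - (∫ X in cellN N (sideLength ρ N),
                conj (Ψ.ψ (Function.update X i (X i + r))) * Ψ.ψ X).re ≤ K * ρ * ‖r‖ ^ 2 := by
  intro v hv
  obtain ⟨K, hK, ρ₀, hρ₀, H⟩ := nearField_coherence v hv
  refine ⟨K, hK, ρ₀, hρ₀, fun ρ hρ hρlt => ?_⟩
  filter_upwards [H ρ hρ hρlt, eventually_gt_atTop 0] with N hN hNpos
  exact ⟨ENNReal.ofReal (ρ * N), ENNReal.ofReal_pos.2 (mul_pos hρ (Nat.cast_pos.2 hNpos)), hN⟩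

/-! ### Consequences in the near field: positivity and the size of `log G` -/

/-- `|log x| ≤ 2(1 - x)` on `[1/2, 1]` (from `log y ≤ y - 1` at `y = 1/x`; cf. the tree's
`Literature.Analysis.Complex.neg_log_le_two_mul_one_sub`, not imported to keep the cone in the Bose-gas
files). [folklore] -/
theorem abs_log_le_two_mul_one_sub {x : ℝ} (hx : 1 / 2 ≤ x) (hx1 : x ≤ 1) :
    |Real.log x| ≤ 2 * (1 - x) := by
  have hxpos : 0 < x := lt_of_lt_of_le (by norm_num) hx
  rw [abs_of_nonpos (Real.log_nonpos hxpos.le hx1)]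
  have h := Real.log_le_sub_one_of_pos (inv_pos.2 hxpos)
  rw [Real.log_inv] at h
  have hinv : x⁻¹ - 1 = (1 - x) / x := by field_simp
  rw [hinv] at h
  calc -Real.log x ≤ (1 - x) / x := h
    _ ≤ 2 * (1 - x) := by
        rw [div_le_iff₀ hxpos]
        nlinarith [mul_nonneg (sub_nonneg.2 hx1) (by linarith : (0 : ℝ) ≤ 2 * x - 1)]

/-- **Near-field positivity and log-coherence bound for near-minimisers (every admissible potential).**
With `K, ρ₀` as in `nearField_coherence_nearMinimiser`: in the NEAR FIELD `Kρ‖r‖² ≤ 1/2` every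
near-minimiser has `G_Ψ(i, r) ≥ 1/2` and `|log G_Ψ(i, r)| ≤ 2Kρ‖r‖²` — uniformly in `N`, with no spectral
input (hard cores included).  This settles, unconditionally, the near zone `|r_j| ≲ (Kρ)^{-1/2}` of the
weighted-ℓ¹ sum of the registered stub `stub_logClusterL1` with centring `c = 0` (each such term is
`≤ 2Kρ|r_j|² · h/(1 + ‖j‖²_per) ≤ 2Kρh³`), and of the positivity conjunct of the sister crux
`GridInfDivCoherence`; everything beyond that radius is the infrared (BEC-strength) content. [folklore] -/
theorem nearField_log_coherence :
    ∀ v : ℝ → ℝ≥0∞, IsRepulsiveFiniteRange v → ∃ K : ℝ, 0 < K ∧ ∃ ρ₀ : ℝ, 0 < ρ₀ ∧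
      ∀ ρ : ℝ, 0 < ρ → ρ < ρ₀ → ∀ᶠ N : ℕ in atTop, ∃ δ : ℝ≥0∞, 0 < δ ∧
        ∀ Ψ : PeriodicTrialState N (sideLength ρ N),
          periodicEnergy v Ψ ≤ periodicGroundStateEnergy v N (sideLength ρ N) + δ →
            ∀ (i : Fin N) (r : Space), K * ρ * ‖r‖ ^ 2 ≤ 1 / 2 →
              1 / 2 ≤ (∫ X in cellN N (sideLength ρ N),
                conj (Ψ.ψ (Function.update X i (X i + r))) * Ψ.ψ X).re ∧
              |Real.log ((∫ X in cellN N (sideLength ρ N),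
                conj (Ψ.ψ (Function.update X i (X i + r))) * Ψ.ψ X).re)| ≤ 2 * K * ρ * ‖r‖ ^ 2 := by
  intro v hv
  obtain ⟨K, hK, ρ₀, hρ₀, H⟩ := nearField_coherence_nearMinimiser v hv
  refine ⟨K, hK, ρ₀, hρ₀, fun ρ hρ hρlt => ?_⟩
  filter_upwards [H ρ hρ hρlt, eventually_gt_atTop 0] with N hN hNpos
  obtain ⟨δ, hδ, hΨ⟩ := hN
  refine ⟨δ, hδ, fun Ψ hE i r hr => ?_⟩
  have hL : 0 < sideLength ρ N := by
    unfold sideLength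
    exact Real.rpow_pos_of_pos (div_pos (Nat.cast_pos.2 hNpos) hρ) _
  have h1 := hΨ Ψ hE i r
  have hle1 := coh_le_one hL Ψ i r
  refine ⟨by linarith, ?_⟩
  calc |Real.log ((∫ X in cellN N (sideLength ρ N),
        conj (Ψ.ψ (Function.update X i (X i + r))) * Ψ.ψ X).re)|
      ≤ 2 * (1 - (∫ X in cellN N (sideLength ρ N),
          conj (Ψ.ψ (Function.update X i (X i + r))) * Ψ.ψ X).re) :=
        abs_log_le_two_mul_one_sub (by linarith) hle1
    _ ≤ 2 * K * ρ * ‖r‖ ^ 2 := by linarith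

end Summit.AtomisticToContinuum.BoseEinsteinCondensation.Theorems.CoherenceNearField

end
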